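import Summits.ResolutionOfSingularities.ResolutionOfSingularities.Theorems.FrobeniusClosingCampaignW41PowerSeriesDerivations
import Literature.RingTheory.MvPowerSeries.FrobeniusPowerBasis
import Mathlib.LinearAlgebra.Matrix.NonsingularInverse
import HarnessLib

/-!
# Crux `Steer` (stmt-16345), r8 `stub_core4Iso`, piece I `isol_transfer` — the FORMAL half (seams Ia/Ib, no completion)

OURS (campaign `res-hironaka`, rung L, slot W4.1, chain W4.1; replaces the role of no printed item; NOT a
statement of the manuscript under review). Lead-1's DICT-SIGS piece I (`isol_transfer`: under a formal chart
`φ : R → κ⟦X⟧` of a regular local `R ⊆ O`, a Jacobian ideal `(δ f : δ ∈ Der_ℤ R)` containing `𝔪 ^ N`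
forces `(X) ^ N ≤ (∂₁ φf, …, ∂_d φf)`) factors as: completion plumbing (`R̂ ≅ k'⟦Y⟧`, `φ̂`, `δ̂` — NOT
here) + the following statements about a ring hom `θ : k'⟦Y⟧ → κ⟦X⟧` of formal power series rings over
FIELDS, all PROVED here WITHOUT the structure theorem `θ = ev_η ∘ map ι'` and without inverting `ev_η`
(STEER-SCOPING §2 I, simplified):

* §1 `leibnizMapAlong_apply_eq_zero` — an additive map `E : k'⟦Y⟧ → κ⟦X⟧` with the Leibniz rule ALONG
  `θ` (`E (ab) = θ a · E b + θ b · E a`), vanishing on constants and variables, vanishes, provided `θ`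
  sends the variables into `𝔪_X` (then `θ (𝔪_Y ^ n) ⊆ 𝔪_X ^ n`, `E (𝔪_Y ^ (n+1)) ⊆ 𝔪_X ^ n`, jets).
* §2 `ringHom_C_eq_C` — for `k'` PERFECT of characteristic `p`, `θ` maps constants to constants (an
  element of `κ⟦X⟧` with `p^e`-th roots for all `e` is constant: `eq_C_of_forall_exists_pow_eq`).
* §3 `pderiv_ringHom_apply` — the CHAIN RULE ALONG `θ`: `∂_l (θ g) = Σ_j ∂_l (θ Y_j) · θ (∂_j g)`.
* §4 `ringHom_pderiv_mem_span_pderiv` — if the Jacobian matrix `(∂_l θ(Y_j))` has unit determinant,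
  `θ (∂_j g) ∈ (∂₁ θg, …, ∂_d θg)`; `isUnit_det_jacobian_of_span_X_le` — unit determinant from
  `(X) ≤ (θ Y₁, …, θ Y_d)` (the FC2 shape: the chart's centre generates `(X)`).
* §5 `ringHom_derivation_apply_mem_span_pderiv`, `map_span_derivation_le_span_pderiv` — for `k'`
  perfect: `θ (δ g) ∈ (∂_l θg)` for EVERY `ℤ`-derivation `δ` of `k'⟦Y⟧` (by the landed structure theorem
  `derivation_int_apply_eq_sum_mul_pderiv`, p475394), hence
  `θ((δ g : δ ∈ Der_ℤ)) κ⟦X⟧ ≤ (∂₁ θg, …, ∂_d θg)` and `θ(I ^ N) ≤ (∂_l θg)` whenever `I ^ N ≤ (δ g : δ)`.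

No `Theses.*` / `Cruxes.*` import (chain build rule). All folklore (Matsumura, *Commutative Ring Theory*,
§25/§30 for derivations of power series rings).
-/

noncomputable section

-- layout-mandated namespace `Summit.<Summit>.<Problem>.…` with Summit = Problem (single-conjunct summit)
set_option linter.dupNamespace false

open MvPowerSeries IsLocalRing
open Literature.RingTheory.MvPowerSeries.Jets
open Literature.AlgebraicGeometry.Resolution

namespace Summit.ResolutionOfSingularities.ResolutionOfSingularities.Theorems.SwitchingDichotomy.Isol

variable {τ : Type*} [Fintype τ] {σ : Type*} [Fintype σ] {k' : Type*} [Field k'] {κ : Type*} [Field κ]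

/-! ### §1 Leibniz maps along a ring hom `θ : k'⟦Y⟧ → κ⟦X⟧` sending variables into `𝔪` -/

omit [Fintype σ] in
/-- A ring hom of power series rings sending every variable into the maximal ideal maps `𝔪_Y` into
`𝔪_X`. [folklore] -/
theorem ringHom_map_maximalIdeal_le (θ : MvPowerSeries τ k' →+* MvPowerSeries σ κ)
    (hθ : ∀ j, constantCoeff (θ (X j)) = 0) :
    Ideal.map θ (maximalIdeal (MvPowerSeries τ k')) ≤ maximalIdeal (MvPowerSeries σ κ) := by
  haveI : Finite τ := Finite.of_fintype τ
  rw [maximalIdeal_mvPowerSeries_eq_span, Ideal.map_span, Ideal.span_le]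
  rintro _ ⟨_, ⟨j, rfl⟩, rfl⟩
  exact mem_maximalIdeal_iff_constantCoeff_eq_zero.mpr (hθ j)

omit [Fintype σ] in
/-- Hence `θ (𝔪_Y ^ n) ⊆ 𝔪_X ^ n`. [folklore] -/
theorem ringHom_apply_mem_maximalIdeal_pow (θ : MvPowerSeries τ k' →+* MvPowerSeries σ κ)
    (hθ : ∀ j, constantCoeff (θ (X j)) = 0) {n : ℕ} {a : MvPowerSeries τ k'}
    (ha : a ∈ maximalIdeal (MvPowerSeries τ k') ^ n) : θ a ∈ maximalIdeal (MvPowerSeries σ κ) ^ n := by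
  have h := Ideal.mem_map_of_mem θ ha
  rw [Ideal.map_pow] at h
  exact Ideal.pow_right_mono (ringHom_map_maximalIdeal_le θ hθ) n h

omit [Fintype τ] [Fintype σ] in
/-- An additive map with the Leibniz rule along `θ`, vanishing on constants and variables, vanishes on
polynomials. [folklore] -/
theorem leibnizMapAlong_apply_coe_eq_zero (θ : MvPowerSeries τ k' →+* MvPowerSeries σ κ)
    (E : MvPowerSeries τ k' →+ MvPowerSeries σ κ) (hmul : ∀ a b, E (a * b) = θ a * E b + θ b * E a)
    (hC : ∀ c : k', E (C c) = 0) (hX : ∀ j : τ, E (X j) = 0) (q : MvPolynomial τ k') :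
    E (q : MvPowerSeries τ k') = 0 := by
  induction q using MvPolynomial.induction_on with
  | C c => rw [MvPolynomial.coe_C]; exact hC c
  | add p q hp hq => rw [MvPolynomial.coe_add, map_add, hp, hq, add_zero]
  | mul_X p i hp => rw [MvPolynomial.coe_mul, MvPolynomial.coe_X, hmul, hX, hp, mul_zero, mul_zero,
      add_zero]

omit [Fintype σ] in
/-- An additive Leibniz map along `θ` sends `𝔪_Y ^ (n+1)` into `𝔪_X ^ n` (`θ` sending variables into
`𝔪_X`). [folklore] -/
theorem leibnizMapAlong_apply_mem_pow (θ : MvPowerSeries τ k' →+* MvPowerSeries σ κ)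
    (hθ : ∀ j, constantCoeff (θ (X j)) = 0)
    (E : MvPowerSeries τ k' →+ MvPowerSeries σ κ) (hmul : ∀ a b, E (a * b) = θ a * E b + θ b * E a)
    (n : ℕ) {a : MvPowerSeries τ k'} (ha : a ∈ maximalIdeal (MvPowerSeries τ k') ^ (n + 1)) :
    E a ∈ maximalIdeal (MvPowerSeries σ κ) ^ n := by
  induction n generalizing a with
  | zero => rw [pow_zero, Ideal.one_eq_top]; exact Submodule.mem_top
  | succ n ih =>
    rw [pow_succ] at ha
    refine Submodule.mul_induction_on ha (fun x hx y hy => ?_) (fun x y hx hy => ?_)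
    · rw [hmul]
      refine Ideal.add_mem _ (Ideal.mul_mem_right _ _ (ringHom_apply_mem_maximalIdeal_pow θ hθ hx)) ?_
      have h1 := Ideal.mul_mem_mul (ih hx) (ringHom_apply_mem_maximalIdeal_pow θ hθ (n := 1)
        (by rw [pow_one]; exact hy))
      rwa [mul_comm (E x), pow_one, ← pow_succ] at h1
    · rw [map_add]
      exact Ideal.add_mem _ hx hy

omit [Fintype σ] in
/-- **An additive Leibniz map along `θ` vanishing on constants and variables is zero** (`θ` sending
variables into `𝔪_X`; polynomials + jets + `𝔪`-adic separation). [folklore] -/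
theorem leibnizMapAlong_apply_eq_zero (θ : MvPowerSeries τ k' →+* MvPowerSeries σ κ)
    (hθ : ∀ j, constantCoeff (θ (X j)) = 0)
    (E : MvPowerSeries τ k' →+ MvPowerSeries σ κ) (hmul : ∀ a b, E (a * b) = θ a * E b + θ b * E a)
    (hC : ∀ c : k', E (C c) = 0) (hX : ∀ j : τ, E (X j) = 0) (f : MvPowerSeries τ k') : E f = 0 := by
  haveI : Finite τ := Finite.of_fintype τ
  ext e
  rw [map_zero]
  set N := e.degree + 1 with hN
  have hsplit : f = ↑(truncTotal (N + 1) f) + (f - ↑(truncTotal (N + 1) f)) := by ring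
  have hr : E (f - ↑(truncTotal (N + 1) f)) ∈ maximalIdeal (MvPowerSeries σ κ) ^ N :=
    leibnizMapAlong_apply_mem_pow θ hθ E hmul N (sub_coe_truncTotal_mem_maximalIdeal_pow (N + 1) f)
  rw [hsplit, map_add, leibnizMapAlong_apply_coe_eq_zero θ E hmul hC hX, zero_add]
  exact coeff_eq_zero_of_mem_maximalIdeal_pow hr (Nat.lt_succ_self _)

/-! ### §2 Constants go to constants when `k'` is perfect -/

omit [Fintype σ] in
/-- In characteristic `p`, an element of `κ⟦X⟧` which is a `p^e`-th power for EVERY `e` is a constant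
(its non-constant coefficients sit at exponents divisible by all `p^e`). [folklore] -/
theorem eq_C_of_forall_exists_pow_eq (p : ℕ) [Fact p.Prime] [CharP κ p] {g : MvPowerSeries σ κ}
    (h : ∀ e : ℕ, ∃ f : MvPowerSeries σ κ, f ^ p ^ e = g) : g = C (constantCoeff g) := by
  classical
  have hp : 1 < p := (Fact.out : p.Prime).one_lt
  ext m
  by_cases hm : m = 0
  · rw [hm, coeff_zero_eq_constantCoeff_apply, coeff_zero_C]
  · rw [coeff_C, if_neg hm]
    obtain ⟨i, hi⟩ : ∃ i, m i ≠ 0 := by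
      by_contra hne
      push Not at hne
      exact hm (Finsupp.ext hne)
    obtain ⟨f, hf⟩ := h (m i)
    rw [← hf]
    refine Literature.RingTheory.MvPowerSeries.isSupportedOnMultiples_pow p f (m i) m ⟨i, ?_⟩
    have h1 : m i < p ^ (m i) := Nat.lt_pow_self hp
    exact fun hdvd => absurd (Nat.le_of_dvd (Nat.pos_of_ne_zero hi) hdvd) (not_le.mpr h1)

omit [Fintype τ] [Fintype σ] in
/-- **A ring hom `θ : k'⟦Y⟧ → κ⟦X⟧` with `k'` PERFECT of characteristic `p` maps constants to constants.**
(`c` has a `p^e`-th root `b_e` for every `e`, so `θ (C c) = θ (C b_e) ^ (p^e)`.) [folklore] -/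
theorem ringHom_C_eq_C (p : ℕ) [Fact p.Prime] [CharP k' p] [PerfectField k'] [CharP κ p]
    (θ : MvPowerSeries τ k' →+* MvPowerSeries σ κ) (c : k') :
    θ (C c) = C (constantCoeff (θ (C c))) := by
  refine eq_C_of_forall_exists_pow_eq p fun e => ?_
  obtain ⟨b, hb⟩ := (bijective_iterateFrobenius k' p e).2 c
  refine ⟨θ (C b), ?_⟩
  rw [← map_pow, ← map_pow, ← hb, iterateFrobenius_def]

/-! ### §3 The chain rule along `θ` -/

omit [Fintype σ] in
/-- **Chain rule along a ring hom of power series rings.** For `θ : k'⟦Y⟧ → κ⟦X⟧` sending variables into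
`𝔪_X` and constants to constants (e.g. `k'` perfect, `ringHom_C_eq_C`):
`∂_l (θ g) = Σ_j ∂_l (θ Y_j) · θ (∂_j g)`. [folklore] -/
theorem pderiv_ringHom_apply (θ : MvPowerSeries τ k' →+* MvPowerSeries σ κ)
    (hθ : ∀ j, constantCoeff (θ (X j)) = 0) (hθC : ∀ c : k', ∃ c' : κ, θ (C c) = C c') (l : σ)
    (g : MvPowerSeries τ k') :
    MvPowerSeries.pderiv l (θ g) = ∑ j, MvPowerSeries.pderiv l (θ (X j)) * θ (MvPowerSeries.pderiv j g) := by
  classical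
  let E : MvPowerSeries τ k' →+ MvPowerSeries σ κ :=
    ((MvPowerSeries.pderiv (R := κ) l).toLinearMap.toAddMonoidHom.comp θ.toAddMonoidHom) -
      ∑ j, (AddMonoidHom.mulLeft (MvPowerSeries.pderiv l (θ (X j)))).comp
        (θ.toAddMonoidHom.comp (MvPowerSeries.pderiv (R := k') j).toLinearMap.toAddMonoidHom)
  have hE : ∀ g, E g = MvPowerSeries.pderiv l (θ g) -
      ∑ j, MvPowerSeries.pderiv l (θ (X j)) * θ (MvPowerSeries.pderiv j g) := fun g => by
    simp only [E, AddMonoidHom.sub_apply, AddMonoidHom.finsetSum_apply, AddMonoidHom.coe_comp,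
      Function.comp_apply, AddMonoidHom.coe_mulLeft, LinearMap.toAddMonoidHom_coe,
      Derivation.coeFn_coe, RingHom.toAddMonoidHom_eq_coe, AddMonoidHom.coe_coe]
  have hmul : ∀ a b, E (a * b) = θ a * E b + θ b * E a := fun a b => by
    rw [hE, hE, hE, map_mul, Derivation.leibniz, smul_eq_mul, smul_eq_mul]
    simp only [Derivation.leibniz, smul_eq_mul, map_add, map_mul, mul_add, Finset.sum_add_distrib,
      mul_sub, Finset.mul_sum]
    ring_nf
  have hCE : ∀ c : k', E (C c) = 0 := fun c => by
    obtain ⟨c', hc'⟩ := hθC c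
    rw [hE, hc']
    simp only [MvPowerSeries.pderiv_C, map_zero, mul_zero, Finset.sum_const_zero, sub_zero]
  have hXE : ∀ j : τ, E (X j) = 0 := fun j => by
    rw [hE]
    simp only [MvPowerSeries.pderiv_X, apply_ite θ, map_one, map_zero, mul_ite, mul_one, mul_zero]
    rw [Finset.sum_ite_eq, if_pos (Finset.mem_univ j), sub_self]
  have h := leibnizMapAlong_apply_eq_zero θ hθ E hmul hCE hXE g
  rw [hE, sub_eq_zero] at h
  exact h

/-! ### §4 Inverting the Jacobian matrix of `θ` -/

/-- **Jacobian inversion.** For `θ : k'⟦Y₁..Y_d⟧ → κ⟦X₁..X_d⟧` sending variables into `𝔪_X` and constants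
to constants, whose Jacobian matrix `(∂_l θ(Y_j))_{j,l}` has unit determinant, every `θ (∂_j g)` lies in the
Jacobian ideal `(∂₁ θg, …, ∂_d θg)` of `θ g` (chain rule along `θ`, then multiply by the inverse matrix).
[folklore] -/
theorem ringHom_pderiv_mem_span_pderiv {d : ℕ}
    (θ : MvPowerSeries (Fin d) k' →+* MvPowerSeries (Fin d) κ)
    (hθ : ∀ j, constantCoeff (θ (X j)) = 0) (hθC : ∀ c : k', ∃ c' : κ, θ (C c) = C c')
    (hJ : IsUnit (Matrix.det (Matrix.of fun j l : Fin d => MvPowerSeries.pderiv l (θ (X j)))))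
    (g : MvPowerSeries (Fin d) k') (j : Fin d) :
    θ (MvPowerSeries.pderiv j g) ∈ Ideal.span (Set.range fun l : Fin d => MvPowerSeries.pderiv l (θ g)) := by
  classical
  set M : Matrix (Fin d) (Fin d) (MvPowerSeries (Fin d) κ) :=
    Matrix.of fun j l : Fin d => MvPowerSeries.pderiv l (θ (X j)) with hM
  set v : Fin d → MvPowerSeries (Fin d) κ := fun j => θ (MvPowerSeries.pderiv j g) with hv
  set w : Fin d → MvPowerSeries (Fin d) κ := fun l => MvPowerSeries.pderiv l (θ g) with hw
  -- the chain rule along `θ`: `w = v ᵥ* M`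
  have hchain : Matrix.vecMul v M = w := by
    funext l
    rw [Matrix.vecMul, dotProduct, hw]
    simp only
    rw [pderiv_ringHom_apply θ hθ hθC l g]
    refine Finset.sum_congr rfl fun i _ => ?_
    rw [hv, hM, Matrix.of_apply, mul_comm]
  -- invert: `v = w ᵥ* M⁻¹`
  have hinv : v = Matrix.vecMul w M⁻¹ := by
    rw [← hchain, Matrix.vecMul_vecMul, Matrix.mul_nonsing_inv M hJ, Matrix.vecMul_one]
  have hvj : v j = ∑ l, w l * M⁻¹ l j := by
    conv_lhs => rw [hinv]
    rfl
  change v j ∈ _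
  rw [hvj]
  exact Ideal.sum_mem _ fun l _ => Ideal.mul_mem_right _ _ (Ideal.subset_span ⟨l, rfl⟩)

/-- **Unit Jacobian determinant from the FC2 shape `(X) ≤ (η₁, …, η_d)`.** If `η : Fin d → κ⟦X₁..X_d⟧`
have zero constant terms and the variables lie in the ideal they generate, the Jacobian matrix
`(∂_l η_j)_{j,l}` has unit determinant: writing `X_l = Σ_j a_{lj} η_j` and taking constant coefficients of
`∂_m`, `A(0) · J(0) = 1`. [folklore] -/
theorem isUnit_det_jacobian_of_span_X_le {d : ℕ} (η : Fin d → MvPowerSeries (Fin d) κ)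
    (h0 : ∀ j, constantCoeff (η j) = 0)
    (hspan : Ideal.span (Set.range (X : Fin d → MvPowerSeries (Fin d) κ)) ≤ Ideal.span (Set.range η)) :
    IsUnit (Matrix.det (Matrix.of fun j l : Fin d => MvPowerSeries.pderiv l (η j))) := by
  classical
  set M : Matrix (Fin d) (Fin d) (MvPowerSeries (Fin d) κ) :=
    Matrix.of fun j l : Fin d => MvPowerSeries.pderiv l (η j) with hM
  -- `X l = Σ_j a l j * η j`
  have ha : ∀ l : Fin d, ∃ a : Fin d → MvPowerSeries (Fin d) κ, ∑ j, a j * η j = X l := fun l =>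
    Ideal.mem_span_range_iff_exists_fun.mp (hspan (Ideal.subset_span ⟨l, rfl⟩))
  choose a ha using ha
  -- constant coefficients: `A₀ * M₀ = 1`
  set cc : MvPowerSeries (Fin d) κ →+* κ := constantCoeff with hcc
  set A₀ : Matrix (Fin d) (Fin d) κ := Matrix.of fun l j => cc (a l j) with hA₀
  have hAM : A₀ * cc.mapMatrix M = 1 := by
    ext l m
    have h := congrArg (fun F => cc (MvPowerSeries.pderiv m F)) (ha l)
    simp only [map_sum] at h
    rw [Matrix.mul_apply, Matrix.one_apply]
    have hrhs : cc (MvPowerSeries.pderiv m (X l : MvPowerSeries (Fin d) κ)) = if l = m then 1 else 0 := by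
      rw [MvPowerSeries.pderiv_X]
      split_ifs <;> simp [hcc]
    rw [← hrhs, ← h]
    refine Finset.sum_congr rfl fun j _ => ?_
    rw [hA₀, Matrix.of_apply, RingHom.mapMatrix_apply, Matrix.map_apply, hM, Matrix.of_apply,
      Derivation.leibniz, smul_eq_mul, smul_eq_mul, map_add, map_mul, map_mul, h0 j, zero_mul, add_zero]
  have hdet : IsUnit (cc.mapMatrix M).det := by
    have h1 : A₀.det * (cc.mapMatrix M).det = 1 := by rw [← Matrix.det_mul, hAM, Matrix.det_one]
    exact IsUnit.of_mul_eq_one_right _ h1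
  rw [← RingHom.map_det] at hdet
  exact (MvPowerSeries.isUnit_iff_constantCoeff (φ := M.det)).mpr (by rw [hcc] at hdet; exact hdet)

/-! ### §5 `ℤ`-derivations of `k'⟦Y⟧` (`k'` perfect) land in the Jacobian ideal of `θ g` -/

/-- **Formal isolation transfer.** For `k'` perfect of characteristic `p`, `θ : k'⟦Y₁..Y_d⟧ → κ⟦X₁..X_d⟧`
sending variables into `𝔪_X` with unit Jacobian determinant, and ANY `ℤ`-derivation `δ` of `k'⟦Y⟧`:
`θ (δ g) ∈ (∂₁ θg, …, ∂_d θg)` — `δ = Σ_j δ(Y_j) ∂_j` (`derivation_int_apply_eq_sum_mul_pderiv`) and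
Jacobian inversion. [folklore] -/
theorem ringHom_derivation_apply_mem_span_pderiv (p : ℕ) [Fact p.Prime] [CharP k' p] [PerfectField k']
    [CharP κ p] {d : ℕ} (θ : MvPowerSeries (Fin d) k' →+* MvPowerSeries (Fin d) κ)
    (hθ : ∀ j, constantCoeff (θ (X j)) = 0)
    (hJ : IsUnit (Matrix.det (Matrix.of fun j l : Fin d => MvPowerSeries.pderiv l (θ (X j)))))
    (δ : Derivation ℤ (MvPowerSeries (Fin d) k') (MvPowerSeries (Fin d) k'))
    (g : MvPowerSeries (Fin d) k') :
    θ (δ g) ∈ Ideal.span (Set.range fun l : Fin d => MvPowerSeries.pderiv l (θ g)) := by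
  have hθC : ∀ c : k', ∃ c' : κ, θ (C c) = C c' := fun c => ⟨_, ringHom_C_eq_C p θ c⟩
  rw [derivation_int_apply_eq_sum_mul_pderiv p δ g, map_sum]
  refine Ideal.sum_mem _ fun j _ => ?_
  rw [map_mul]
  exact Ideal.mul_mem_left _ _ (ringHom_pderiv_mem_span_pderiv θ hθ hθC hJ g j)

/-- The image under `θ` of the intrinsic Jacobian ideal `(δ g : δ ∈ Der_ℤ k'⟦Y⟧)` lies in the Jacobian
ideal `(∂_l θg)` of `θ g` (hypotheses as in `ringHom_derivation_apply_mem_span_pderiv`). [folklore] -/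
theorem map_span_derivation_le_span_pderiv (p : ℕ) [Fact p.Prime] [CharP k' p] [PerfectField k']
    [CharP κ p] {d : ℕ} (θ : MvPowerSeries (Fin d) k' →+* MvPowerSeries (Fin d) κ)
    (hθ : ∀ j, constantCoeff (θ (X j)) = 0)
    (hJ : IsUnit (Matrix.det (Matrix.of fun j l : Fin d => MvPowerSeries.pderiv l (θ (X j)))))
    (g : MvPowerSeries (Fin d) k') :
    Ideal.map θ (Ideal.span (Set.range fun δ : Derivation ℤ (MvPowerSeries (Fin d) k')
      (MvPowerSeries (Fin d) k') => δ g)) ≤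
      Ideal.span (Set.range fun l : Fin d => MvPowerSeries.pderiv l (θ g)) := by
  rw [Ideal.map_span, Ideal.span_le]
  rintro _ ⟨_, ⟨δ, rfl⟩, rfl⟩
  exact ringHom_derivation_apply_mem_span_pderiv p θ hθ hJ δ g

/-- **Isolation transfer, formal form.** If an ideal `I` of `k'⟦Y⟧` has `I ^ N` inside the intrinsic
Jacobian ideal of `g`, then `(θ I) ^ N` lies inside the Jacobian ideal of `θ g` (so with `θ(𝔪_Y) κ⟦X⟧ = (X)`,
the FC2 shape, `(X) ^ N ≤ (∂_l θg)`). [folklore] -/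
theorem map_pow_le_span_pderiv (p : ℕ) [Fact p.Prime] [CharP k' p] [PerfectField k'] [CharP κ p]
    {d : ℕ} (θ : MvPowerSeries (Fin d) k' →+* MvPowerSeries (Fin d) κ)
    (hθ : ∀ j, constantCoeff (θ (X j)) = 0)
    (hJ : IsUnit (Matrix.det (Matrix.of fun j l : Fin d => MvPowerSeries.pderiv l (θ (X j)))))
    (g : MvPowerSeries (Fin d) k') {I : Ideal (MvPowerSeries (Fin d) k')} {N : ℕ}
    (hI : I ^ N ≤ Ideal.span (Set.range fun δ : Derivation ℤ (MvPowerSeries (Fin d) k')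
      (MvPowerSeries (Fin d) k') => δ g)) :
    Ideal.map θ I ^ N ≤ Ideal.span (Set.range fun l : Fin d => MvPowerSeries.pderiv l (θ g)) := by
  rw [← Ideal.map_pow]
  exact (Ideal.map_mono hI).trans (map_span_derivation_le_span_pderiv p θ hθ hJ g)

/-- The same with the unit-determinant hypothesis replaced by the FC2 shape
`(X) ≤ (θ Y₁, …, θ Y_d)`. [folklore] -/
theorem map_pow_le_span_pderiv_of_span_X_le (p : ℕ) [Fact p.Prime] [CharP k' p] [PerfectField k']
    [CharP κ p] {d : ℕ} (θ : MvPowerSeries (Fin d) k' →+* MvPowerSeries (Fin d) κ)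
    (hθ : ∀ j, constantCoeff (θ (X j)) = 0)
    (hspan : Ideal.span (Set.range (X : Fin d → MvPowerSeries (Fin d) κ)) ≤
      Ideal.span (Set.range fun j : Fin d => θ (X j)))
    (g : MvPowerSeries (Fin d) k') {I : Ideal (MvPowerSeries (Fin d) k')} {N : ℕ}
    (hI : I ^ N ≤ Ideal.span (Set.range fun δ : Derivation ℤ (MvPowerSeries (Fin d) k')
      (MvPowerSeries (Fin d) k') => δ g)) :
    Ideal.map θ I ^ N ≤ Ideal.span (Set.range fun l : Fin d => MvPowerSeries.pderiv l (θ g)) :=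
  map_pow_le_span_pderiv p θ hθ (isUnit_det_jacobian_of_span_X_le (fun j => θ (X j)) hθ hspan) g hI

end Summit.ResolutionOfSingularities.ResolutionOfSingularities.Theorems.SwitchingDichotomy.Isol

end
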